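import Summits.QuantumAdvantage.QuantumAdvantage.Theorems.AbelianDialB

/-! # AbelianDialC — part 3/5 of the landing twins of NODE «AbelianDial» (decomp-qadv lens-2; node file
`g23/AbelianDial.lean`, sha256 4845a3792d6530ec…; generator `g23/tree/gen_twins.py`: namespace
`Theses.AbelianDial` → `Theorems.AbelianDial`, cut at declaration boundaries, docstrings added where missing, nothing else).
Content: §4 the GENERIC inhabitant `qStrat` (rotating quadratic matchings) and its pigeonhole certificate
`q_not_tableForm_zero : ∀ m r, ∀ n ≥ 2(m+1)^r+4, ¬ (m,r)-table-form at the zero gauge`, `q_not_counterForm_zero`, `q_in_dense_class`. -/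

set_option linter.dupNamespace false
noncomputable section
open scoped Classical

namespace Summit.QuantumAdvantage.QuantumAdvantage.Theorems.AbelianDial
open Finset
open Literature.Computability.QuantumComplexity Literature.Computability.QuantumComplexity.RingHLF
open Literature.Computability.MetaComplexity Literature.Computability.MetaComplexity.Smolensky
open Summit.QuantumAdvantage.AdviceFreeQNC0
open Summit.QuantumAdvantage.QuantumAdvantage.Theorems.AnchorDial (outB dev orbF oddZeros_orbF orbF_apply_of_far
  card_filter_orbF card_odd_ge loss_shape_mono)
open Summit.QuantumAdvantage.QuantumAdvantage.Theorems.HolonomyDial (tPoly tPoly_apply tPoly_mem xorP xorP_mem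
  xorP_apply_bool indP indP_apply indP_mem mono_singleton_apply)
open Summit.QuantumAdvantage.QuantumAdvantage.Theorems.StabilizerDial (apIdx apStrat apStrat_mem bitP bitP_apStrat pad
  pad_mem rel_pad_iff StabFew outB_pad_pad outB_pad_congr bitP_gsum gsum gsum_mem deg_gsum dev_congr)
open Summit.QuantumAdvantage.QuantumAdvantage.Theorems.SparsityDial (real_loss_of_frac stabFew_mono_mr one_le_logpow)
open Summit.QuantumAdvantage.QuantumAdvantage.Theorems.ResponseDial (mem_dev_apStrat dev_pad_zero
  not_polylogSparse_of_agree AddResp additive_loss_count lodd lodd_mem lodd_eq_sum lodd_orbF oddSite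
  oddSite_val oddSite_odd card_exists_orbF_le fibre_le_pow orbF_apply)
open Summit.QuantumAdvantage.QuantumAdvantage.Theorems.CounterDial (bsel mem_iff_bsel)
open Summit.QuantumAdvantage.QuantumAdvantage.Theorems.CounterDial (lin CounterForm StabCounter Dark dw dw_apply_of_far
  oddZeros_dw dark_loss_count)
open Summit.QuantumAdvantage.QuantumAdvantage.Theorems.BlindDial (apIdx_val_first)

variable {N : ℕ}

/-! ## §4  The GENERIC inhabitant: the quadratic MATCHING family — certified non-abelian for EVERY bounded type

Position `k` outside the first half-cycle toggles the canonical guess by `[Q_k(x) ≡ 0 (mod 3)]`, `Q_k(x) = Σ_t x_{2t+1}·x_{q_k(t)}`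
the number of MATCHED PAIRS (odd cell `2t+1` ↔ even cell `q_k(t) = 2((t+k) mod T)+2`, a matching ROTATED with the position:
position-diverse quadratic phases). First half-cycle = the antipodal pointer (certified density, as every exemplar). -/

/-- number of matched pairs `T = ⌊(N-1)/2⌋`. -/
def nT (N : ℕ) : ℕ := (N - 1) / 2

/-- the odd cell `2t+1` of pair `t`. -/
def pcell (t : Fin (nT N)) : Fin N := ⟨2 * t.val + 1, by have := t.isLt; unfold nT at this; omega⟩

/-- the even partner cell of pair `t` at position `k`: `2((t+k) mod T) + 2`. -/
def qcell (k : Fin N) (t : Fin (nT N)) : Fin N :=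
  ⟨2 * ((t.val + k.val) % nT N) + 2, by
    have hT : 0 < nT N := lt_of_le_of_lt (Nat.zero_le _) t.isLt
    have h1 := Nat.mod_lt (t.val + k.val) hT
    have h2 : 2 * nT N ≤ N - 1 := by unfold nT; omega
    omega⟩

/-- the odd cell of pair `t` is cell `2t + 1`. -/
theorem pcell_val (t : Fin (nT N)) : (pcell t).val = 2 * t.val + 1 := rfl

/-- the even partner cell of pair `t` at position `k` is cell `2((t + k) mod T) + 2`. -/
theorem qcell_val (k : Fin N) (t : Fin (nT N)) : (qcell k t).val = 2 * ((t.val + k.val) % nT N) + 2 := rfl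

/-- distinct pairs have distinct odd cells. -/
theorem pcell_injective : Function.Injective (pcell : Fin (nT N) → Fin N) := fun t t' h => by
  have h1 := congrArg Fin.val h
  rw [pcell_val, pcell_val] at h1
  exact Fin.ext (by omega)

/-- at a fixed position, distinct pairs have distinct even partner cells. -/
theorem qcell_injective (k : Fin N) : Function.Injective (qcell k : Fin (nT N) → Fin N) := fun t t' h => by
  have h1 := congrArg Fin.val h
  rw [qcell_val, qcell_val] at h1
  have hme : (t.val + k.val) % nT N = (t'.val + k.val) % nT N := by omega
  have h3 : t.val % nT N = t'.val % nT N := Nat.ModEq.add_right_cancel' k.val hme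
  rw [Nat.mod_eq_of_lt t.isLt, Nat.mod_eq_of_lt t'.isLt] at h3
  exact Fin.ext h3

/-- an odd cell is never an even partner cell. -/
theorem pcell_ne_qcell (k : Fin N) (s t : Fin (nT N)) : pcell s ≠ qcell k t := fun h => by
  have h1 := congrArg Fin.val h
  rw [pcell_val, qcell_val] at h1
  omega

/-- the matching count `Q_k = Σ_t x_{pcell t} x_{qcell k t}` as an `𝔽₃`-polynomial (degree 2). -/
def qG (k : Fin N) : CubeFn (ZMod 3) N := ∑ t : Fin (nT N), mono (ZMod 3) {pcell t, qcell k t}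

/-- the matching-count polynomial `qG k` has degree `≤ 2`. -/
theorem qG_mem (k : Fin N) : qG k ∈ lowDeg (ZMod 3) N 2 :=
  Submodule.sum_mem _ fun _ _ => mono_mem_lowDeg Finset.card_le_two

/-- `qG k` evaluates to the number of MATCHED pairs (both cells set), read in `Z₃`. -/
theorem qG_apply (k : Fin N) (y : Fin N → Bool) :
    qG k y = ∑ t : Fin (nT N), if (y (pcell t) = true ∧ y (qcell k t) = true) then (1 : ZMod 3) else 0 := by
  unfold qG
  rw [Finset.sum_apply]
  refine sum_congr rfl fun t _ => ?_
  rw [mono_apply]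
  by_cases hp : y (pcell t) = true <;> by_cases hq : y (qcell k t) = true <;> simp [hp, hq]

/-- **the quadratic MATCHING family** (degree 6). -/
def qStrat (k : Fin N) : CubeFn (ZMod 3) N :=
  if 1 ≤ k.val ∧ k.val < N / 2 then apStrat k else xorP (tPoly k) (indP (qG k) 0)

/-- on the first half-cycle `qStrat` IS the antipodal pointer `apStrat` (certified density). -/
theorem qStrat_agree (n : ℕ) (k : Fin n) (h1 : 1 ≤ k.val) (h2 : k.val < n / 2) : qStrat k = apStrat k := by
  unfold qStrat; rw [if_pos ⟨h1, h2⟩]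

/-- every `qStrat k` has degree `≤ 6`. -/
theorem qStrat_mem6 (k : Fin N) : qStrat k ∈ lowDeg (ZMod 3) N 6 := by
  unfold qStrat
  split_ifs
  · exact lowDeg_mono (by norm_num) (apStrat_mem k)
  · have h : xorP (tPoly k) (indP (qG k) 0) ∈ lowDeg (ZMod 3) N (2 + (2 + 2)) :=
      xorP_mem (tPoly_mem k) (indP_mem (qG_mem k) 0)
    exact lowDeg_mono (show 2 + (2 + 2) ≤ 6 by norm_num) h

/-- the matching family is in the dense class `(c ≥ 1)`: degree `≤ (log n)^c` and not stabilizer-few, eventually. -/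
theorem q_in_dense_class (a c : ℕ) (hc : 1 ≤ c) :
    ∃ n₀ : ℕ, ∀ n ≥ n₀, (∀ i : Fin n, qStrat i ∈ lowDeg (ZMod 3) n ((Nat.log 2 n) ^ c)) ∧
      ¬ StabFew ((Nat.log 2 n) ^ a) 0 (c + 1) (fun j : Fin n => qStrat j) := by
  obtain ⟨n₀, hn₀⟩ := not_polylogSparse_of_agree (fun n (j : Fin n) => qStrat j)
    (fun n j h1 h2 => qStrat_agree n j h1 h2) a (c + 1)
  refine ⟨max n₀ 64, fun n hn => ⟨fun i => lowDeg_mono ?_ (qStrat_mem6 i), hn₀ n (le_trans (le_max_left _ _) hn)⟩⟩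
  have h64 : 2 ^ 6 ≤ n := le_trans (le_max_right _ _) hn
  have hL : 6 ≤ Nat.log 2 n := Nat.le_log_of_pow_le (by norm_num) h64
  calc 6 ≤ Nat.log 2 n := hL
    _ = (Nat.log 2 n) ^ 1 := (pow_one _).symm
    _ ≤ (Nat.log 2 n) ^ c := Nat.pow_le_pow_right (by omega) hc

/-- deviation of the matching family outside the first half-cycle: `k` deviates iff `Q_k(y) ≡ 0`. -/
theorem mem_dev_q_second (y : Fin N → Bool) (k : Fin N) (hk : ¬ (1 ≤ k.val ∧ k.val < N / 2)) :
    k ∈ dev (fun i : Fin N => qStrat i) y ↔ decide (qG k y = 0) = true := by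
  have happ : qStrat k y = if xor (tGuess y k) (decide (qG k y = 0)) then 1 else 0 := by
    unfold qStrat; rw [if_neg hk]
    exact xorP_apply_bool _ _ y _ _ (tPoly_apply k y) (by rw [indP_apply]; by_cases h : qG k y = 0 <;> simp [h])
  simp only [Summit.QuantumAdvantage.QuantumAdvantage.Theorems.AnchorDial.dev, mem_filter, mem_univ, true_and, happ]
  generalize tGuess y k = t; generalize decide (qG k y = 0) = q
  cases t <;> cases q <;> decide

/-- the indicator input of a set of cells. -/
def indB (S : Finset (Fin N)) (i : Fin N) : Bool := decide (i ∈ S)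

/-- the indicator input of `S` has an odd number of zeros iff `N − #S` is odd. -/
theorem oddZeros_indB (S : Finset (Fin N)) : OddZeros (indB S) ↔ (N - S.card) % 2 = 1 := by
  unfold OddZeros
  have e : (univ.filter fun i : Fin N => indB S i = false) = univ \ S := by
    ext i; simp [indB, mem_sdiff]
  rw [e, card_univ_sdiff, Fintype.card_fin]

/-- the abelian readout of the indicator input of `S` is the sum over `S` of the rows of the coefficient table. -/
theorem alin_indB (m r : ℕ) (v : Fin N → Fin r → ZMod (m + 1)) (S : Finset (Fin N)) :
    alin m r v (indB S) = fun j => ∑ i ∈ S, v i j := by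
  funext j
  unfold alin indB
  simp only [decide_eq_true_eq]
  rw [← Finset.sum_filter]
  congr 1
  ext i; simp

/-- `qG k` at the indicator input of `S` counts the pairs `t` with both `pcell t ∈ S` and `qcell k t ∈ S`. -/
theorem qG_indB (k : Fin N) (S : Finset (Fin N)) :
    qG k (indB S) = ∑ t : Fin (nT N), if (pcell t ∈ S ∧ qcell k t ∈ S) then (1 : ZMod 3) else 0 := by
  rw [qG_apply]
  refine sum_congr rfl fun t _ => ?_
  simp only [indB, decide_eq_true_eq]

/-- the separating pair of inputs behind the pigeonhole: `{pcell t, qcell k₀ t'} ∪ C` versus `{pcell t, qcell k₀ t} ∪ C`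
(`C ⊆ {cell 0}` fixes the zero-parity) have the same abelian readout at `k₀` once the two partner columns collide, but
matching counts `0` and `1`. -/
theorem q_sep (hN : 3 ≤ N) {m r : ℕ} {v : Fin N → Fin N → Fin r → ZMod (m + 1)}
    {G : Fin N → (Fin r → ZMod (m + 1)) → Bool} (hF : TableForm m r v G (pad (fun i : Fin N => qStrat i) (fun _ => 0)))
    (C : Finset (Fin N)) (hC0 : ∀ i ∈ C, i.val = 0) (hpar : (N - (C.card + 2)) % 2 = 1) {t t' : Fin (nT N)}
    (htt : t ≠ t') (hcol : v ⟨N - 1, by omega⟩ (qcell ⟨N - 1, by omega⟩ t) = v ⟨N - 1, by omega⟩ (qcell ⟨N - 1, by omega⟩ t')) :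
    False := by
  set k₀ : Fin N := ⟨N - 1, by omega⟩ with hk₀
  have hk : ¬ (1 ≤ k₀.val ∧ k₀.val < N / 2) := by simp only [hk₀]; omega
  -- non-membership facts
  have hpC : ∀ s, pcell s ∉ C := fun s h => by have := hC0 _ h; rw [pcell_val] at this; omega
  have hqC : ∀ s, qcell k₀ s ∉ C := fun s h => by have := hC0 _ h; rw [qcell_val] at this; omega
  set B₀ : Finset (Fin N) := insert (pcell t) C with hB₀
  have hqB : ∀ s, qcell k₀ s ∉ B₀ := fun s h => by
    rcases mem_insert.1 h with h | h
    · exact pcell_ne_qcell k₀ t s h.symm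
    · exact hqC s h
  have hB₀card : B₀.card = C.card + 1 := card_insert_of_notMem (hpC t)
  set SA : Finset (Fin N) := insert (qcell k₀ t') B₀ with hSA
  set SB : Finset (Fin N) := insert (qcell k₀ t) B₀ with hSB
  have hSAcard : SA.card = C.card + 2 := by rw [card_insert_of_notMem (hqB t'), hB₀card]
  have hSBcard : SB.card = C.card + 2 := by rw [card_insert_of_notMem (hqB t), hB₀card]
  have hoddA : OddZeros (indB SA) := by rw [oddZeros_indB, hSAcard]; exact hpar
  have hoddB : OddZeros (indB SB) := by rw [oddZeros_indB, hSBcard]; exact hpar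
  -- membership in SA / SB
  have memA : ∀ i, i ∈ SA ↔ i = qcell k₀ t' ∨ i = pcell t ∨ i ∈ C := fun i => by
    rw [hSA, mem_insert, hB₀, mem_insert]
  have memB : ∀ i, i ∈ SB ↔ i = qcell k₀ t ∨ i = pcell t ∨ i ∈ C := fun i => by
    rw [hSB, mem_insert, hB₀, mem_insert]
  -- equal abelian readouts
  have halin : alin m r (v k₀) (indB SA) = alin m r (v k₀) (indB SB) := by
    rw [alin_indB, alin_indB]
    funext j
    rw [hSA, hSB, sum_insert (hqB t'), sum_insert (hqB t), ← hcol]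
  -- matching counts
  have hqA : qG k₀ (indB SA) = 0 := by
    rw [qG_indB]
    refine sum_eq_zero fun s _ => ?_
    rw [if_neg]
    rintro ⟨hp, hq⟩
    rcases (memA _).1 hp with h | h | h
    · exact pcell_ne_qcell k₀ s t' h
    · have hs : s = t := pcell_injective h
      subst hs
      rcases (memA _).1 hq with h' | h' | h'
      · exact htt (qcell_injective k₀ h')
      · exact pcell_ne_qcell k₀ s s h'.symm
      · exact hqC s h'
    · exact hpC s h
  have hqB' : qG k₀ (indB SB) = 1 := by
    rw [qG_indB, sum_eq_single t]
    · rw [if_pos ⟨(memB _).2 (Or.inr (Or.inl rfl)), (memB _).2 (Or.inl rfl)⟩]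
    · intro s _ hs
      rw [if_neg]
      rintro ⟨hp, -⟩
      rcases (memB _).1 hp with h | h | h
      · exact pcell_ne_qcell k₀ s t h
      · exact hs (pcell_injective h)
      · exact hpC s h
    · intro h; exact absurd (mem_univ t) h
  -- the table cannot tell the two inputs apart, the matching count does
  have hA := hF (indB SA) hoddA k₀
  have hB := hF (indB SB) hoddB k₀
  rw [dev_pad_zero, mem_dev_q_second _ k₀ hk] at hA hB
  rw [hqA, halin] at hA
  rw [hqB'] at hB
  have h1 : G k₀ (alin m r (v k₀) (indB SB)) = true := hA.1 (by decide)
  exact absurd (hB.2 h1) (by decide)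

/-- **★ THE NON-ABELIAN CERTIFICATE**: for EVERY bounded abelian type `(m, r)`, once the number of pairs exceeds
`(m+1)^r` (i.e. `N ≥ 2(m+1)^r + 3`), the matching family is NOT in `(m, r)`-table form at the zero gauge — by pigeonhole on
the partner columns of the coefficient table at position `N-1` (no character sum, no rank bound: a COLLISION argument). -/
theorem q_not_tableForm (hN : 3 ≤ N) {m r : ℕ} (hT : (m + 1) ^ r < nT N)
    (v : Fin N → Fin N → Fin r → ZMod (m + 1)) (G : Fin N → (Fin r → ZMod (m + 1)) → Bool) :
    ¬ TableForm m r v G (pad (fun i : Fin N => qStrat i) (fun _ => 0)) := by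
  intro hF
  have hcard : Fintype.card (Fin r → ZMod (m + 1)) < Fintype.card (Fin (nT N)) := by
    rw [Fintype.card_fun, ZMod.card, Fintype.card_fin, Fintype.card_fin]; exact hT
  obtain ⟨t, t', htt, hcol⟩ :=
    Fintype.exists_ne_map_eq_of_card_lt (fun s : Fin (nT N) => v ⟨N - 1, by omega⟩ (qcell ⟨N - 1, by omega⟩ s)) hcard
  by_cases hpar : N % 2 = 0
  · refine q_sep hN hF {⟨0, by omega⟩} (fun i hi => by rw [mem_singleton.1 hi]) ?_ htt hcol
    rw [card_singleton]; omega
  · refine q_sep hN hF ∅ (fun i hi => absurd hi (notMem_empty _)) ?_ htt hcol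
    rw [card_empty]; omega

/-- hence: for every `(m, r)`, EVENTUALLY (`n ≥ 2(m+1)^r + 4`) the matching family is not `(m, r)`-table-form at the zero
gauge — the generic piece's hypothesis class is inhabited at every type (zero gauge; see the memo for the gauge caveat). -/
theorem q_not_tableForm_zero (m r : ℕ) : ∀ n ≥ 2 * (m + 1) ^ r + 4,
    ¬ ∃ (v : Fin n → Fin n → Fin r → ZMod (m + 1)) (G : Fin n → (Fin r → ZMod (m + 1)) → Bool),
      TableForm m r v G (pad (fun i : Fin n => qStrat i) (fun _ => 0)) := by
  rintro n hn ⟨v, G, h⟩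
  have h1 : 1 ≤ (m + 1) ^ r := Nat.one_le_pow _ _ (by omega)
  exact q_not_tableForm (by omega) (by unfold nT; omega) v G h

/-- in particular (type `(2, 1)` = counter form, §2) the matching family is NOT COUNTER-FORM at the zero gauge (`n ≥ 10`):
it inhabits B's hypothesis class (dense, `¬` counter-form) — with no finite core, by the same collision. -/
theorem q_not_counterForm_zero : ∀ n ≥ 10,
    ¬ ∃ (a : Fin n → Fin n → ZMod 3) (A : Fin n → Finset (ZMod 3)),
      CounterForm a A (pad (fun i : Fin n => qStrat i) (fun _ => 0)) := by
  rintro n hn ⟨a, A, h⟩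
  exact q_not_tableForm_zero 2 1 n (by norm_num; omega) ⟨_, _, tableForm_of_counterForm h⟩

end Summit.QuantumAdvantage.QuantumAdvantage.Theorems.AbelianDial
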